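import Literature.NumberTheory.GaloisRepresentations.CyclicLayerSurjective
import Literature.NumberTheory.GaloisRepresentations.GaloisCohomology
import Literature.NumberTheory.GaloisRepresentations.AbsGaloisGroupProofs
import Literature.NumberTheory.GaloisRepresentations.AbsGaloisGroupOpenNormal
import Literature.NumberTheory.GaloisRepresentations.LocalWeilDatum
import Mathlib.Topology.Algebra.ClopenNhdofOne
import HarnessLib

/-!
# Brauer classes as explicit locally constant `2`-cocycles `Γ_F × Γ_F → F̄ˣ`

Topic `NumberTheory/GaloisRepresentations` (Galois cohomology of `F̄ˣ`, `Br(F) = H²(Γ_F, F̄ˣ)`);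
namespace `Literature.NumberTheory.GaloisRepresentations`.  Proof file: theorems only (no definition,
no instance, no named fact; D-0026).

The consumer (`Literature.NumberTheory.EllipticCurves.Cassels1962_index_eq_period_of_mem_sha` via
the Hasse principle for `H²(K, K̄ˣ)`) handles Brauer classes as **explicit locally constant
`2`-cocycles** `e : Γ_F × Γ_F → F̄ˣ` (`e(σ,τ) e(στ,υ) = σe(τ,υ) e(σ,τυ)`), coboundaries being
`e(σ,τ) = b(σ) σb(τ) b(στ)⁻¹` with `b` locally constant; the tree's cohomology of the discrete module
`F̄ˣ` (`DiscreteGaloisModule.units`, `ContinuousH2`) is by continuous inhomogeneous cocycles with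
values in `UnitsCarrier F = Additive F̄ˣ`.  This file is the dictionary between the two and the
cocycle-level bookkeeping behind "restriction is well defined up to inner automorphisms":

* `conj_twoCocycle_eq` — **conjugation changes a `2`-cocycle by an explicit coboundary**:
  `g e(g⁻¹xg, g⁻¹yg) = e(x,y) ∂c(x,y)`, `c(x) = e(g,g⁻¹xg)/e(x,g)` (Serre, *Corps locaux* VII §5
  Prop. 3 in degree `2`); `exists_cob_of_exists_cob_conj` — a coboundary on `g S g⁻¹` is one on `S`;
* `exists_contTwoCocycles_eq`, `twoCocycleClass_eq_zero_iff_exists_mul`,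
  `resH_twoCocycleClass_eq_zero_iff_exists_mul`, `exists_contTwoCocycles_pow_eq`,
  `twoCocycleClass_natCast_smul`, `exists_unitsHom` — **dictionary**: `e` defines
  `f ∈ contTwoCocycles (units F)` with `f(σ,τ) = ofUnits (e σ τ)`; `[f] = 0` (resp. `res_S [f] = 0`)
  iff `e` is a coboundary (resp. on `S`); powers of `e` are multiples of `f`; the units map along a
  field extension as a morphism of representations;
* `exists_cob_pullback`, `twoCocycle_pow`, `exists_cob_pow` — pull-backs and powers of coboundaries;
* `exists_cob_pullback_iff_of_compatible` — **independence of the embedding**: the pull-back to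
  `Γ_L` along any compatible pair `(r' : Γ_L → Γ_F, ι' : F̄ →ₐ L̄)` is a coboundary iff the pull-back
  along the standard pair `(absGaloisRestrict, absClosureEmbedding)` is (`ι' = ι ∘ τ`,
  `exists_absClosureEmbedding_comp_eq`, so `r' = τ⁻¹ res τ`, and conjugation is a coboundary);
* `exists_cob_range_of_exists_cob` — for `L/F` algebraic, a coboundary over `Γ_L` descends to a
  coboundary on the image `res(Γ_L) ≤ Γ_F` (`res` is an embedding, `ι` is bijective);
* `exists_intermediateField_isGalois_cob` — **finite level**: every locally constant `e` is a
  coboundary on `Gal(F̄/L)` for some finite Galois `L/F` (`e` is constant `= a` on `N × N` for an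
  open normal `N` fixing `a`, and `N = Gal(F̄/L)`, `exists_isGalois_fixingSubgroup_eq`), i.e.
  `H²(Γ_F, F̄ˣ) = ⋃_L Br(L/F)` (Serre I §2.2 Cor. 1).

## References

* J.-P. Serre, *Cohomologie galoisienne* / *Galois Cohomology* (1997), I §2.2 (Prop. 8, Cor. 1),
  I §2.3, I §2.4 (compatible pairs), II §1.1. [SerreGaloisCohomology1997]
* J.-P. Serre, *Corps locaux* / *Local Fields* (1979), VII §5 Prop. 3 (inner automorphisms act
  trivially on cohomology). [SerreLocalFields1979]
-/

noncomputable section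

open CategoryTheory Topology

universe u

namespace Literature.NumberTheory.GaloisRepresentations

open _root_.TopRep _root_.ContRepresentation _root_.ContinuousCohomology DiscreteGaloisModule Field

/-! ### Conjugation: an inner automorphism changes a `2`-cocycle by an explicit coboundary -/

section Conj

variable {G : Type*} [Group G] {A : Type*} [CommGroup A] [MulDistribMulAction G A]

/-- **Inner automorphisms act trivially on `2`-cocycles, explicitly**: for a `2`-cocycle
`e : G × G → A` (`e(σ,τ) e(στ,υ) = σe(τ,υ) e(σ,τυ)`) and `g ∈ G`,
`g • e(g⁻¹xg, g⁻¹yg) = e(x,y) · c(x) · x•c(y) · c(xy)⁻¹` with `c(x) = e(g, g⁻¹xg) e(x, g)⁻¹`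
(the cocycle identity at `(g, g⁻¹xg, g⁻¹yg)`, `(x, g, g⁻¹yg)` and `(x, y, g)`).  This is the
degree-`2` case of "conjugation induces the identity on cohomology" (Serre, *Corps locaux* VII §5,
Prop. 3). [cite: SerreLocalFields1979, VII §5 Prop. 3] -/
theorem conj_twoCocycle_eq (e : G → G → A)
    (hcoc : ∀ σ τ υ, e σ τ * e (σ * τ) υ = σ • e τ υ * e σ (τ * υ)) (g x y : G) :
    g • e (g⁻¹ * x * g) (g⁻¹ * y * g) =
      e x y * ((e g (g⁻¹ * x * g) / e x g) * x • (e g (g⁻¹ * y * g) / e y g) /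
        (e g (g⁻¹ * (x * y) * g) / e (x * y) g)) := by
  have hXY : g⁻¹ * (x * y) * g = g⁻¹ * x * g * (g⁻¹ * y * g) := by group
  have h1 := hcoc g (g⁻¹ * x * g) (g⁻¹ * y * g)
  have h2 := hcoc x g (g⁻¹ * y * g)
  have h3 := hcoc x y g
  rw [show g * (g⁻¹ * x * g) = x * g by group] at h1
  rw [show g * (g⁻¹ * y * g) = y * g by group] at h2
  rw [← hXY] at h1
  rw [smul_div']
  -- everything is now commutative algebra in `A`
  have e1 : g • e (g⁻¹ * x * g) (g⁻¹ * y * g) = e g (g⁻¹ * x * g) * e (x * g) (g⁻¹ * y * g) /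
      e g (g⁻¹ * (x * y) * g) := by
    rw [eq_div_iff_mul_eq', ← h1]
  have e2 : e (x * g) (g⁻¹ * y * g) = x • e g (g⁻¹ * y * g) * e x (y * g) / e x g := by
    rw [eq_div_iff_mul_eq', mul_comm, h2]
  have e3 : e x (y * g) = e x y * e (x * y) g / x • e y g := by
    rw [eq_div_iff_mul_eq', mul_comm, ← h3]
  rw [e1, e2, e3]
  apply Additive.ofMul.injective
  simp only [ofMul_mul, ofMul_div]
  abel

end Conj

/-! ### Explicit cocycles `Γ_F × Γ_F → F̄ˣ` and the tree's continuous cohomology of `F̄ˣ` -/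

section Toolkit

variable (F : Type u) [Field F] [CharZero F]

omit [CharZero F] in
/-- The action of `Γ_F` on the module `F̄ˣ` (`DiscreteGaloisModule.units`, carrier
`UnitsCarrier F = Additive F̄ˣ`) is the Galois action: `σ · u = σ • u`. [folklore] -/
theorem units_apply_ofUnits (σ : absoluteGaloisGroup F) (u : (AlgebraicClosure F)ˣ) :
    units F σ (UnitsCarrier.ofUnits u) = UnitsCarrier.ofUnits (σ • u) := rfl

omit [CharZero F] in
/-- `ofUnits` turns products into sums. [folklore] -/
theorem ofUnits_mul (u u' : (AlgebraicClosure F)ˣ) :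
    UnitsCarrier.ofUnits (u * u') = UnitsCarrier.ofUnits (K := F) u + UnitsCarrier.ofUnits u' := rfl

omit [CharZero F] in
/-- `ofUnits` turns quotients into differences. [folklore] -/
theorem ofUnits_div (u u' : (AlgebraicClosure F)ˣ) :
    UnitsCarrier.ofUnits (u / u') = UnitsCarrier.ofUnits (K := F) u - UnitsCarrier.ofUnits u' := rfl

omit [CharZero F] in
/-- `ofUnits` turns powers into multiples. [folklore] -/
theorem ofUnits_pow (u : (AlgebraicClosure F)ˣ) (k : ℕ) :
    UnitsCarrier.ofUnits (u ^ k) = k • UnitsCarrier.ofUnits (K := F) u := rfl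

omit [CharZero F] in
/-- `ofUnits` is injective (it is the identity of `F̄ˣ` onto `Additive F̄ˣ`). [folklore] -/
theorem ofUnits_injective : Function.Injective (UnitsCarrier.ofUnits (K := F)) := fun _ _ h => h

omit [CharZero F] in
/-- Every element of the carrier is `ofUnits` of its underlying unit. [folklore] -/
theorem ofUnits_toMul (x : UnitsCarrier F) :
    UnitsCarrier.ofUnits ((UnitsCarrier.toAdditive x).toMul) = x := rfl

variable {F}

omit [CharZero F] in
/-- **An explicit locally constant `2`-cocycle `e : Γ_F × Γ_F → F̄ˣ` defines a continuous
inhomogeneous `2`-cocycle of the tree's module `F̄ˣ`** (`ContinuousH2.contTwoCocycles`), with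
values `ofUnits (e σ τ)`. [cite: SerreGaloisCohomology1997, I §2.2–2.3] -/
theorem exists_contTwoCocycles_eq
    (e : absoluteGaloisGroup F → absoluteGaloisGroup F → (AlgebraicClosure F)ˣ)
    (hlc : IsLocallyConstant fun p : absoluteGaloisGroup F × absoluteGaloisGroup F => e p.1 p.2)
    (hcoc : ∀ σ τ υ, e σ τ * e (σ * τ) υ = σ • e τ υ * e σ (τ * υ)) :
    ∃ f : contTwoCocycles (units F).toTopRep,
      ∀ σ τ, f.1 (σ, τ) = UnitsCarrier.ofUnits (e σ τ) := by
  let f₀ : C(absoluteGaloisGroup F × absoluteGaloisGroup F, UnitsCarrier F) :=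
    ⟨fun p => UnitsCarrier.ofUnits (e p.1 p.2),
      (IsLocallyConstant.comp hlc _).continuous⟩
  refine ⟨⟨f₀, fun σ τ υ => ?_⟩, fun σ τ => rfl⟩
  change units F σ (UnitsCarrier.ofUnits (e τ υ)) + UnitsCarrier.ofUnits (e σ (τ * υ)) =
    UnitsCarrier.ofUnits (e (σ * τ) υ) + UnitsCarrier.ofUnits (e σ τ)
  rw [units_apply_ofUnits, ← ofUnits_mul, ← ofUnits_mul, ← hcoc, mul_comm]

/-- **The class of the cocycle vanishes iff `e` is the coboundary of a locally constant
`1`-cochain**: `[e] = 0 ↔ ∃ b, e(σ,τ) = b(σ) · σb(τ) / b(στ)` (`twoCocycleClass_eq_zero_iff` in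
multiplicative form). [cite: SerreGaloisCohomology1997, I §2.3] -/
theorem twoCocycleClass_eq_zero_iff_exists_mul
    (e : absoluteGaloisGroup F → absoluteGaloisGroup F → (AlgebraicClosure F)ˣ)
    (f : contTwoCocycles (units F).toTopRep) (hf : ∀ σ τ, f.1 (σ, τ) = UnitsCarrier.ofUnits (e σ τ)) :
    twoCocycleClass _ f = 0 ↔
      ∃ b : absoluteGaloisGroup F → (AlgebraicClosure F)ˣ, IsLocallyConstant b ∧
        ∀ σ τ, e σ τ = b σ * σ • b τ / b (σ * τ) := by
  rw [twoCocycleClass_eq_zero_iff]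
  constructor
  · rintro ⟨b, hb⟩
    refine ⟨fun σ => (UnitsCarrier.toAdditive (b σ)).toMul,
      ((IsLocallyConstant.iff_continuous b).mpr b.continuous).comp _, fun σ τ => ?_⟩
    apply ofUnits_injective F
    have key : f.1 (σ, τ) = units F σ (b τ) - b (σ * τ) + b σ := hb σ τ
    rw [← hf, key, ofUnits_div, ofUnits_mul, ← units_apply_ofUnits, ofUnits_toMul, ofUnits_toMul,
      ofUnits_toMul]
    abel
  · rintro ⟨b, hb, hbe⟩
    refine ⟨⟨fun σ => UnitsCarrier.ofUnits (b σ), (hb.comp _).continuous⟩, fun σ τ => ?_⟩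
    change f.1 (σ, τ) = units F σ (UnitsCarrier.ofUnits (b τ)) - UnitsCarrier.ofUnits (b (σ * τ)) +
      UnitsCarrier.ofUnits (b σ)
    rw [hf, hbe, units_apply_ofUnits, ofUnits_div, ofUnits_mul]
    abel

/-- **Restriction to a closed subgroup `S` vanishes iff `e` is a coboundary on `S`**
(`resH S [e] = 0 ↔ ∃ b : S → F̄ˣ, e(x,y) = b(x) · x b(y) / b(xy)` for `x, y ∈ S`).
[cite: SerreGaloisCohomology1997, I §2.4] -/
theorem resH_twoCocycleClass_eq_zero_iff_exists_mul (S : Subgroup (absoluteGaloisGroup F))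
    [LocallyCompactSpace S]
    (e : absoluteGaloisGroup F → absoluteGaloisGroup F → (AlgebraicClosure F)ˣ)
    (f : contTwoCocycles (units F).toTopRep) (hf : ∀ σ τ, f.1 (σ, τ) = UnitsCarrier.ofUnits (e σ τ)) :
    resH S (units F) 2 (twoCocycleClass _ f) = 0 ↔
      ∃ b : S → (AlgebraicClosure F)ˣ, IsLocallyConstant b ∧
        ∀ x y : S, e x y = b x * (x : absoluteGaloisGroup F) • b y / b (x * y) := by
  rw [resH_twoCocycleClass, twoCocycleClass_eq_zero_iff]
  constructor
  · rintro ⟨b, hb⟩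
    refine ⟨fun x => (UnitsCarrier.toAdditive (b x)).toMul,
      ((IsLocallyConstant.iff_continuous b).mpr b.continuous).comp _, fun x y => ?_⟩
    apply ofUnits_injective F
    have key : f.1 ((x : absoluteGaloisGroup F), (y : absoluteGaloisGroup F)) =
        units F (x : absoluteGaloisGroup F) (b y) - b (x * y) + b x := hb x y
    rw [← hf, key, ofUnits_div, ofUnits_mul, ← units_apply_ofUnits, ofUnits_toMul, ofUnits_toMul,
      ofUnits_toMul]
    abel
  · rintro ⟨b, hb, hbe⟩
    refine ⟨⟨fun x => UnitsCarrier.ofUnits (b x), (hb.comp _).continuous⟩, fun x y => ?_⟩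
    change f.1 ((x : absoluteGaloisGroup F), (y : absoluteGaloisGroup F)) =
      units F (x : absoluteGaloisGroup F) (UnitsCarrier.ofUnits (b y)) -
        UnitsCarrier.ofUnits (b (x * y)) + UnitsCarrier.ofUnits (b x)
    rw [hf, hbe, units_apply_ofUnits, ofUnits_div, ofUnits_mul]
    abel

omit [CharZero F] in
/-- **Powers of the cocycle are multiples of its continuous cocycle.** [folklore] -/
theorem exists_contTwoCocycles_pow_eq
    (e : absoluteGaloisGroup F → absoluteGaloisGroup F → (AlgebraicClosure F)ˣ)
    (f : contTwoCocycles (units F).toTopRep) (hf : ∀ σ τ, f.1 (σ, τ) = UnitsCarrier.ofUnits (e σ τ))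
    (k : ℕ) : ∀ σ τ, ((k : ℤ) • f).1 (σ, τ) = UnitsCarrier.ofUnits (e σ τ ^ k) := by
  intro σ τ
  rw [ofUnits_pow, ← natCast_zsmul, ← hf]
  rfl

/-- The class of `(k : ℤ) • f` is `k • [f]`. [folklore] -/
theorem twoCocycleClass_natCast_smul (f : contTwoCocycles (units F).toTopRep) (k : ℕ) :
    twoCocycleClass _ ((k : ℤ) • f) = k • twoCocycleClass _ f := by
  rw [twoCocycleClass_smul, ← natCast_zsmul (twoCocycleClass _ f) k]
  exact int_smul_eq_zsmul _ _ _

omit [CharZero F] in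
/-- **The units map along a field extension as a morphism of topological representations**
(existence): for `L/F` there is a morphism `res(Γ_L → Γ_F) F̄ˣ ⟶ L̄ˣ` of `Γ_L`-representations
acting as `u ↦ ι(u)` for the chosen `ι : F̄ → L̄` (`absClosureEmbedding`; equivariance
`absGaloisRestrict_apply_smul`). [cite: SerreGaloisCohomology1997, II §1.1] -/
theorem exists_unitsHom (L : Type u) [Field L] [Algebra F L] :
    ∃ φ : TopRep.res ((absGaloisRestrict F L : absoluteGaloisGroup L →ₜ* absoluteGaloisGroup F) :
        absoluteGaloisGroup L →* absoluteGaloisGroup F) (units F).toTopRep ⟶ (units L).toTopRep,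
      ∀ u : (AlgebraicClosure F)ˣ, φ.hom (UnitsCarrier.ofUnits u) =
        UnitsCarrier.ofUnits (Units.map (absClosureEmbedding F L : AlgebraicClosure F →* AlgebraicClosure L) u) := by
  let ψ : UnitsCarrier F →+ UnitsCarrier L :=
    { toFun := fun x => UnitsCarrier.ofUnits
        (Units.map (absClosureEmbedding F L : AlgebraicClosure F →* AlgebraicClosure L)
          (UnitsCarrier.toAdditive x).toMul)
      map_zero' := by
        change UnitsCarrier.ofUnits (Units.map _ 1) = 0
        rw [map_one]; rfl
      map_add' := fun x y => by
        change UnitsCarrier.ofUnits (Units.map _ ((UnitsCarrier.toAdditive x).toMul *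
          (UnitsCarrier.toAdditive y).toMul)) = _
        rw [map_mul, ofUnits_mul] }
  have hψ : ∀ u, ψ (UnitsCarrier.ofUnits u) =
      UnitsCarrier.ofUnits (Units.map (absClosureEmbedding F L : AlgebraicClosure F →* AlgebraicClosure L) u) :=
    fun u => rfl
  have hequiv : ∀ (x : absoluteGaloisGroup L) (m : UnitsCarrier F),
      ψ (units F (absGaloisRestrict F L x) m) = units L x (ψ m) := by
    intro x m
    rw [← ofUnits_toMul F m, units_apply_ofUnits, hψ, hψ, units_apply_ofUnits]
    refine congrArg _ (Units.ext ?_)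
    change absClosureEmbedding F L (absGaloisRestrict F L x • ((UnitsCarrier.toAdditive m).toMul : AlgebraicClosure F)) =
      x • absClosureEmbedding F L ((UnitsCarrier.toAdditive m).toMul : AlgebraicClosure F)
    exact absGaloisRestrict_apply_smul F L x _
  refine ⟨TopRep.ofHom
    { toLinearMap := ψ.toIntLinearMap
      cont := continuous_of_discreteTopology
      isIntertwining' := fun x => by ext m; exact hequiv x m }, fun u => rfl⟩

end Toolkit

/-! ### Coboundaries: pull-back, powers, conjugate subgroups -/

section Cob

variable {F : Type u} [Field F]

/-- **Coboundaries pull back along compatible pairs**: if `e` is a coboundary on `Γ_F` then so is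
`(x, y) ↦ ι(e(r x, r y))` on a topological group `H`, for a continuous homomorphism `r : H → Γ_F`
and a multiplicative `ι` with `ι(r(x) • a) = x • ι(a)`. [cite: SerreGaloisCohomology1997, I §2.4] -/
theorem exists_cob_pullback {H : Type*} [Group H] [TopologicalSpace H] {B : Type*} [CommGroup B]
    [MulAction H B]
    (e : absoluteGaloisGroup F → absoluteGaloisGroup F → (AlgebraicClosure F)ˣ)
    (r : H →* absoluteGaloisGroup F) (hr : Continuous r) (ι : (AlgebraicClosure F)ˣ →* B)
    (hι : ∀ (x : H) (a : (AlgebraicClosure F)ˣ), ι (r x • a) = x • ι a)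
    (h : ∃ b : absoluteGaloisGroup F → (AlgebraicClosure F)ˣ, IsLocallyConstant b ∧
      ∀ σ τ, e σ τ = b σ * σ • b τ / b (σ * τ)) :
    ∃ b : H → B, IsLocallyConstant b ∧ ∀ x y, ι (e (r x) (r y)) = b x * x • b y / b (x * y) := by
  obtain ⟨b, hb, hbe⟩ := h
  refine ⟨fun x => ι (b (r x)), (hb.comp_continuous hr).comp _, fun x y => ?_⟩
  change _ = ι (b (r x)) * x • ι (b (r y)) / ι (b (r (x * y)))
  rw [hbe, map_div, map_mul, hι, map_mul r]

/-- **Powers of a cocycle are cocycles** (locally constant, same identity). [folklore] -/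
theorem twoCocycle_pow (e : absoluteGaloisGroup F → absoluteGaloisGroup F → (AlgebraicClosure F)ˣ)
    (hlc : IsLocallyConstant fun p : absoluteGaloisGroup F × absoluteGaloisGroup F => e p.1 p.2)
    (hcoc : ∀ σ τ υ, e σ τ * e (σ * τ) υ = σ • e τ υ * e σ (τ * υ)) (k : ℕ) :
    IsLocallyConstant (fun p : absoluteGaloisGroup F × absoluteGaloisGroup F => e p.1 p.2 ^ k) ∧
      ∀ σ τ υ, e σ τ ^ k * e (σ * τ) υ ^ k = σ • e τ υ ^ k * e σ (τ * υ) ^ k :=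
  ⟨hlc.comp fun u => u ^ k, fun σ τ υ => by rw [← mul_pow, hcoc, mul_pow, smul_pow']⟩

/-- Powers of coboundaries are coboundaries (on a subgroup). [folklore] -/
theorem exists_cob_pow (S : Subgroup (absoluteGaloisGroup F))
    (e : absoluteGaloisGroup F → absoluteGaloisGroup F → (AlgebraicClosure F)ˣ) (k : ℕ)
    (h : ∃ b : S → (AlgebraicClosure F)ˣ, IsLocallyConstant b ∧
      ∀ x y : S, e x y = b x * (x : absoluteGaloisGroup F) • b y / b (x * y)) :
    ∃ b : S → (AlgebraicClosure F)ˣ, IsLocallyConstant b ∧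
      ∀ x y : S, e x y ^ k = b x * (x : absoluteGaloisGroup F) • b y / b (x * y) := by
  obtain ⟨b, hb, hbe⟩ := h
  exact ⟨fun x => b x ^ k, hb.comp fun u => u ^ k, fun x y => by
    rw [hbe, div_pow, mul_pow, smul_pow']⟩

/-- The correction cochain of `conj_twoCocycle_eq` is locally constant. [folklore] -/
theorem isLocallyConstant_conjCochain
    (e : absoluteGaloisGroup F → absoluteGaloisGroup F → (AlgebraicClosure F)ˣ)
    (hlc : IsLocallyConstant fun p : absoluteGaloisGroup F × absoluteGaloisGroup F => e p.1 p.2)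
    (g : absoluteGaloisGroup F) :
    IsLocallyConstant fun x : absoluteGaloisGroup F => e g (g⁻¹ * x * g) / e x g := by
  have h1 : IsLocallyConstant fun x : absoluteGaloisGroup F => e g (g⁻¹ * x * g) :=
    hlc.comp_continuous (f := fun x : absoluteGaloisGroup F => (g, g⁻¹ * x * g)) (by fun_prop)
  have h2 : IsLocallyConstant fun x : absoluteGaloisGroup F => e x g :=
    hlc.comp_continuous (f := fun x : absoluteGaloisGroup F => (x, g)) (by fun_prop)
  exact (h1.prodMk h2).comp fun p => p.1 / p.2

/-- **A cocycle which is a coboundary on a conjugate `g S g⁻¹` of a subgroup is a coboundary on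
`S`** (conjugation changes a cocycle by an explicit locally constant coboundary,
`conj_twoCocycle_eq`). [cite: SerreLocalFields1979, VII §5 Prop. 3] -/
theorem exists_cob_of_exists_cob_conj
    (e : absoluteGaloisGroup F → absoluteGaloisGroup F → (AlgebraicClosure F)ˣ)
    (hlc : IsLocallyConstant fun p : absoluteGaloisGroup F × absoluteGaloisGroup F => e p.1 p.2)
    (hcoc : ∀ σ τ υ, e σ τ * e (σ * τ) υ = σ • e τ υ * e σ (τ * υ))
    (S : Subgroup (absoluteGaloisGroup F)) (g : absoluteGaloisGroup F)
    (h : ∃ b : ↥(S.map (MulAut.conj g).toMonoidHom) → (AlgebraicClosure F)ˣ, IsLocallyConstant b ∧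
      ∀ x y : ↥(S.map (MulAut.conj g).toMonoidHom),
        e x y = b x * (x : absoluteGaloisGroup F) • b y / b (x * y)) :
    ∃ b : S → (AlgebraicClosure F)ˣ, IsLocallyConstant b ∧
      ∀ x y : S, e x y = b x * (x : absoluteGaloisGroup F) • b y / b (x * y) := by
  obtain ⟨b, hb, hbe⟩ := h
  -- `φ : S → g S g⁻¹`, `x ↦ g x g⁻¹`
  have hmem : ∀ x : S, g * x * g⁻¹ ∈ S.map (MulAut.conj g).toMonoidHom := fun x =>
    Subgroup.mem_map.mpr ⟨x, x.2, rfl⟩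
  let φ : S → ↥(S.map (MulAut.conj g).toMonoidHom) := fun x => ⟨g * x * g⁻¹, hmem x⟩
  have hφ : Continuous φ := by
    refine Continuous.subtype_mk ?_ _
    fun_prop
  have hφmul : ∀ x y : S, φ (x * y) = φ x * φ y := fun x y => Subtype.ext (by
    change g * (x * y : absoluteGaloisGroup F) * g⁻¹ = g * x * g⁻¹ * (g * y * g⁻¹)
    group)
  -- the correction cochain at `g⁻¹`
  set c : absoluteGaloisGroup F → (AlgebraicClosure F)ˣ :=
    fun x => e g⁻¹ (g⁻¹⁻¹ * x * g⁻¹) / e x g⁻¹ with hc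
  have hcl : IsLocallyConstant c := isLocallyConstant_conjCochain e hlc g⁻¹
  refine ⟨fun x => g⁻¹ • b (φ x) / c x, ?_, fun x y => ?_⟩
  · exact (((hb.comp_continuous hφ).comp fun u => g⁻¹ • u).prodMk
      (hcl.comp_continuous continuous_subtype_val)).comp fun p => p.1 / p.2
  · have key := conj_twoCocycle_eq e hcoc g⁻¹ x y
    rw [inv_inv] at key
    -- `g⁻¹ • e (g x g⁻¹) (g y g⁻¹) = e x y * (c x * x • c y / c (x y))`
    change g⁻¹ • e (g * x * g⁻¹) (g * y * g⁻¹) = e x y * (c x * (x : absoluteGaloisGroup F) • c y / c (x * y))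
      at key
    change e x y = g⁻¹ • b (φ x) / c x * (x : absoluteGaloisGroup F) • (g⁻¹ • b (φ y) / c y) /
      (g⁻¹ • b (φ (x * y)) / c (x * y))
    have hexy' : e (g * x * g⁻¹) (g * y * g⁻¹) = b (φ x) * (g * x * g⁻¹) • b (φ y) / b (φ (x * y)) := by
      have := hbe (φ x) (φ y)
      rw [← hφmul] at this
      exact this
    rw [hexy', smul_div', smul_mul', smul_smul, show g⁻¹ * (g * (x : absoluteGaloisGroup F) * g⁻¹) =
      (x : absoluteGaloisGroup F) * g⁻¹ by group, ← smul_smul] at key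
    rw [smul_div']
    -- solve for `e x y`
    have key' : e x y = g⁻¹ • b (φ x) * (x : absoluteGaloisGroup F) • g⁻¹ • b (φ y) /
        g⁻¹ • b (φ (x * y)) / (c x * (x : absoluteGaloisGroup F) • c y / c (x * y)) := by
      rw [eq_div_iff_mul_eq', ← key]
    rw [key']
    apply Additive.ofMul.injective
    simp only [ofMul_mul, ofMul_div]
    abel

end Cob

/-! ### Independence of the embedding; pulling coboundaries back to `Γ_F` -/

section Embedding

variable (F : Type u) [Field F] (L : Type u) [Field L] [Algebra F L]

/-- Two cocycles differing by a locally constant coboundary are coboundaries together. [folklore] -/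
theorem exists_cob_iff_of_eq_mul_cob {H : Type*} [Group H] [TopologicalSpace H] {B : Type*}
    [CommGroup B] [MulDistribMulAction H B] (e₁ e₂ : H → H → B) (C : H → B) (hC : IsLocallyConstant C)
    (h : ∀ x y, e₂ x y = e₁ x y * (C x * x • C y / C (x * y))) :
    (∃ b : H → B, IsLocallyConstant b ∧ ∀ x y, e₁ x y = b x * x • b y / b (x * y)) ↔
      ∃ b : H → B, IsLocallyConstant b ∧ ∀ x y, e₂ x y = b x * x • b y / b (x * y) := by
  constructor
  · rintro ⟨b, hb, hbe⟩
    refine ⟨fun x => b x * C x, (hb.prodMk hC).comp fun p => p.1 * p.2, fun x y => ?_⟩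
    rw [h, hbe]
    change _ = b x * C x * x • (b y * C y) / (b (x * y) * C (x * y))
    rw [smul_mul']
    apply Additive.ofMul.injective
    simp only [ofMul_mul, ofMul_div]
    abel
  · rintro ⟨b, hb, hbe⟩
    refine ⟨fun x => b x / C x, (hb.prodMk hC).comp fun p => p.1 / p.2, fun x y => ?_⟩
    have := hbe x y
    rw [h] at this
    have h2 : e₁ x y = b x * x • b y / b (x * y) / (C x * x • C y / C (x * y)) :=
      eq_div_iff_mul_eq'.mpr this
    rw [h2]
    change _ = b x / C x * x • (b y / C y) / (b (x * y) / C (x * y))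
    rw [smul_div']
    apply Additive.ofMul.injective
    simp only [ofMul_mul, ofMul_div]
    abel

/-- **Independence of the embedding**: the pull-back of `e` to `Γ_L` along any compatible pair
`(r' : Γ_L → Γ_F, ι' : F̄ → L̄)` (`ι'(r'(x) m) = x ι'(m)`, `ι'` an `F`-embedding) is a coboundary
iff the pull-back along the tree's standard pair `(absGaloisRestrict, absClosureEmbedding)` is one:
`ι' = ι ∘ τ` for some `τ ∈ Γ_F` (`exists_absClosureEmbedding_comp_eq`), whence
`r' = τ⁻¹ res τ`, and conjugation by `τ` changes `e` by an explicit coboundary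
(`conj_twoCocycle_eq`). [cite: SerreGaloisCohomology1997, I §2.4 (compatible pairs), II §1.1] -/
theorem exists_cob_pullback_iff_of_compatible
    (e : absoluteGaloisGroup F → absoluteGaloisGroup F → (AlgebraicClosure F)ˣ)
    (hlc : IsLocallyConstant fun p : absoluteGaloisGroup F × absoluteGaloisGroup F => e p.1 p.2)
    (hcoc : ∀ σ τ υ, e σ τ * e (σ * τ) υ = σ • e τ υ * e σ (τ * υ))
    (ι' : AlgebraicClosure F →ₐ[F] AlgebraicClosure L)
    (r' : absoluteGaloisGroup L → absoluteGaloisGroup F)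
    (hr' : ∀ (x : absoluteGaloisGroup L) (m : AlgebraicClosure F), ι' (r' x • m) = x • ι' m) :
    (∃ b : absoluteGaloisGroup L → (AlgebraicClosure L)ˣ, IsLocallyConstant b ∧ ∀ x y,
        Units.map (ι' : AlgebraicClosure F →* AlgebraicClosure L) (e (r' x) (r' y)) =
          b x * x • b y / b (x * y)) ↔
      ∃ b : absoluteGaloisGroup L → (AlgebraicClosure L)ˣ, IsLocallyConstant b ∧ ∀ x y,
        Units.map (absClosureEmbedding F L : AlgebraicClosure F →* AlgebraicClosure L)
            (e (absGaloisRestrict F L x) (absGaloisRestrict F L y)) = b x * x • b y / b (x * y) := by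
  obtain ⟨τ, hτ⟩ := exists_absClosureEmbedding_comp_eq F L ι'
  -- `r' x = τ⁻¹ (res x) τ`
  have hr : ∀ x, r' x = τ⁻¹ * absGaloisRestrict F L x * τ := by
    intro x
    have h1 : τ * r' x = absGaloisRestrict F L x * τ := by
      apply FaithfulSMul.eq_of_smul_eq_smul (α := AlgebraicClosure F)
      intro m
      apply (absClosureEmbedding F L).toRingHom.injective
      change absClosureEmbedding F L ((τ * r' x) • m) = absClosureEmbedding F L ((absGaloisRestrict F L x * τ) • m)
      rw [mul_smul, mul_smul, hτ, hr', ← hτ, ← absGaloisRestrict_apply_smul]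
    rw [mul_assoc, ← h1, inv_mul_cancel_left]
  -- compare the two pull-backs through `conj_twoCocycle_eq` at `τ`
  set c : absoluteGaloisGroup F → (AlgebraicClosure F)ˣ := fun X => e τ (τ⁻¹ * X * τ) / e X τ with hc
  have hcl : IsLocallyConstant c := isLocallyConstant_conjCochain e hlc τ
  refine (exists_cob_iff_of_eq_mul_cob _ _
    (fun x => Units.map (absClosureEmbedding F L : AlgebraicClosure F →* AlgebraicClosure L)
      (c (absGaloisRestrict F L x)))
    ((hcl.comp_continuous (absGaloisRestrict F L).continuous).comp _) fun x y => ?_).symm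
  -- the value of the primed pull-back
  have hι' : ∀ u : (AlgebraicClosure F)ˣ,
      Units.map (ι' : AlgebraicClosure F →* AlgebraicClosure L) u =
        Units.map (absClosureEmbedding F L : AlgebraicClosure F →* AlgebraicClosure L) (τ • u) := by
    intro u
    ext
    change ι' (u : AlgebraicClosure F) = absClosureEmbedding F L ((τ • u : (AlgebraicClosure F)ˣ) : AlgebraicClosure F)
    rw [Units.coe_smul, hτ]
  have hcompat : ∀ (x : absoluteGaloisGroup L) (u : (AlgebraicClosure F)ˣ),
      Units.map (absClosureEmbedding F L : AlgebraicClosure F →* AlgebraicClosure L)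
        (absGaloisRestrict F L x • u) =
        x • Units.map (absClosureEmbedding F L : AlgebraicClosure F →* AlgebraicClosure L) u := by
    intro x u
    ext
    change absClosureEmbedding F L ((absGaloisRestrict F L x • u : (AlgebraicClosure F)ˣ) : AlgebraicClosure F) =
      x • absClosureEmbedding F L (u : AlgebraicClosure F)
    rw [Units.coe_smul, absGaloisRestrict_apply_smul]
  rw [hι', hr, hr, conj_twoCocycle_eq e hcoc τ, map_mul, map_div, map_mul, hcompat, ← map_mul]

end Embedding

/-! ### From a coboundary over `L` to a coboundary on `res(Γ_L) ≤ Γ_F` (`L/F` algebraic) -/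

section Range

variable (F : Type u) [Field F] [CharZero F] (L : Type u) [Field L] [Algebra F L] [Algebra.IsAlgebraic F L]

/-- **If the pull-back of `e` to `Γ_L` is a coboundary, then `e` is a coboundary on the image
`res(Γ_L) ≤ Γ_F`** (`L/F` algebraic, so `res : Γ_L → Γ_F` is a topological embedding and the chosen
`ι : F̄ → L̄` is bijective; the cochain is transported along both).
[cite: SerreGaloisCohomology1997, I §2.4, II §1.1] -/
theorem exists_cob_range_of_exists_cob
    (e : absoluteGaloisGroup F → absoluteGaloisGroup F → (AlgebraicClosure F)ˣ)
    (h : ∃ b : absoluteGaloisGroup L → (AlgebraicClosure L)ˣ, IsLocallyConstant b ∧ ∀ x y,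
      Units.map (absClosureEmbedding F L : AlgebraicClosure F →* AlgebraicClosure L)
        (e (absGaloisRestrict F L x) (absGaloisRestrict F L y)) = b x * x • b y / b (x * y)) :
    ∃ b : (absGaloisRestrict F L : absoluteGaloisGroup L →* absoluteGaloisGroup F).range →
        (AlgebraicClosure F)ˣ, IsLocallyConstant b ∧
      ∀ x y : (absGaloisRestrict F L : absoluteGaloisGroup L →* absoluteGaloisGroup F).range,
        e x y = b x * (x : absoluteGaloisGroup F) • b y / b (x * y) := by
  classical
  haveI : CharZero L := charZero_of_injective_algebraMap (algebraMap F L).injective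
  obtain ⟨b, hb, hbe⟩ := h
  -- `res` as a homeomorphism onto its image
  have hrinj : Function.Injective (absGaloisRestrict F L) := absGaloisRestrict_injective F L
  let ψ₀ : absoluteGaloisGroup L ≃
      (absGaloisRestrict F L : absoluteGaloisGroup L →* absoluteGaloisGroup F).range :=
    (Equiv.ofInjective (absGaloisRestrict F L) hrinj).trans (Equiv.setCongr (by rfl))
  have hψ₀ : Continuous ψ₀ := by
    refine Continuous.subtype_mk ?_ _
    exact (absGaloisRestrict F L).continuous
  let ψ : absoluteGaloisGroup L ≃ₜ
      (absGaloisRestrict F L : absoluteGaloisGroup L →* absoluteGaloisGroup F).range :=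
    hψ₀.homeoOfEquivCompactToT2
  have hψ : ∀ x, ((ψ x : (absGaloisRestrict F L : absoluteGaloisGroup L →* absoluteGaloisGroup F).range) :
      absoluteGaloisGroup F) = absGaloisRestrict F L x := fun x => rfl
  have hψsymm : ∀ s : (absGaloisRestrict F L : absoluteGaloisGroup L →* absoluteGaloisGroup F).range,
      absGaloisRestrict F L (ψ.symm s) = s := fun s => by
    rw [← hψ, ψ.apply_symm_apply]
  have hψmul : ∀ s t : (absGaloisRestrict F L : absoluteGaloisGroup L →* absoluteGaloisGroup F).range,
      ψ.symm (s * t) = ψ.symm s * ψ.symm t := fun s t => by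
    apply hrinj
    rw [map_mul (absGaloisRestrict F L) (ψ.symm s) (ψ.symm t), hψsymm, hψsymm, hψsymm]
    rfl
  -- `ι⁻¹` on units
  let ιE : (AlgebraicClosure F)ˣ ≃* (AlgebraicClosure L)ˣ := Units.mapEquiv (absClosureEquiv F L).toMulEquiv
  have hιE : ∀ u, ιE u = Units.map (absClosureEmbedding F L : AlgebraicClosure F →* AlgebraicClosure L) u :=
    fun u => Units.ext rfl
  have hcompat : ∀ (x : absoluteGaloisGroup L) (u : (AlgebraicClosure F)ˣ),
      ιE (absGaloisRestrict F L x • u) = x • ιE u := by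
    intro x u
    ext
    change absClosureEmbedding F L ((absGaloisRestrict F L x • u : (AlgebraicClosure F)ˣ) : AlgebraicClosure F) =
      x • absClosureEmbedding F L (u : AlgebraicClosure F)
    rw [Units.coe_smul, absGaloisRestrict_apply_smul]
  refine ⟨fun s => ιE.symm (b (ψ.symm s)), ?_, fun s t => ?_⟩
  · exact (hb.comp_continuous ψ.symm.continuous).comp _
  · apply ιE.injective
    have key := hbe (ψ.symm s) (ψ.symm t)
    rw [hψsymm, hψsymm, ← hιE] at key
    change ιE (e s t) = ιE (ιE.symm (b (ψ.symm s)) * (s : absoluteGaloisGroup F) • ιE.symm (b (ψ.symm t)) /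
      ιE.symm (b (ψ.symm (s * t))))
    rw [key, map_div, map_mul, ← hψsymm s, hcompat, MulEquiv.apply_symm_apply,
      MulEquiv.apply_symm_apply, hψmul, MulEquiv.apply_symm_apply]

end Range

/-! ### Every class dies on an open normal subgroup: the finite level -/

section FiniteLevel

variable (F : Type u) [Field F] [CharZero F]

/-- **Every locally constant `2`-cocycle `Γ_F × Γ_F → F̄ˣ` is a coboundary on `Gal(F̄/L)` for some
finite Galois `L/F` inside `F̄`**: being locally constant on the compact group, `e` is constant,
say `= a`, on `N × N` for an open normal subgroup `N` which moreover fixes `a`; there `e` is the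
coboundary of the constant cochain `a`; and `N = Gal(F̄/L)` for a finite Galois `L`
(`exists_isGalois_fixingSubgroup_eq`).  (`H²(Γ_F, F̄ˣ) = lim→ H²(Gal(L/F), Lˣ)`, Serre I §2.2
Cor. 1.) [cite: SerreGaloisCohomology1997, I §2.2 Prop. 8 and Cor. 1] -/
theorem exists_intermediateField_isGalois_cob
    (e : absoluteGaloisGroup F → absoluteGaloisGroup F → (AlgebraicClosure F)ˣ)
    (hlc : IsLocallyConstant fun p : absoluteGaloisGroup F × absoluteGaloisGroup F => e p.1 p.2) :
    ∃ L : IntermediateField F (AlgebraicClosure F), FiniteDimensional F L ∧ IsGalois F L ∧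
      ∃ b : LocalWeilDatum.galFixing F L → (AlgebraicClosure F)ˣ, IsLocallyConstant b ∧
        ∀ x y : LocalWeilDatum.galFixing F L,
          e x y = b x * (x : absoluteGaloisGroup F) • b y / b (x * y) := by
  classical
  set a : (AlgebraicClosure F)ˣ := e 1 1 with ha
  -- `e = a` near `(1, 1)`: on `U × U`
  have hV : {p : absoluteGaloisGroup F × absoluteGaloisGroup F | e p.1 p.2 = a} ∈ 𝓝 ((1, 1) :
      absoluteGaloisGroup F × absoluteGaloisGroup F) :=
    (hlc.isOpen_fiber a).mem_nhds rfl
  obtain ⟨U₁, hU₁, U₂, hU₂, hUU⟩ := mem_nhds_prod_iff.mp hV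
  -- the stabiliser of `a` is a neighbourhood of `1`
  have hS : {σ : absoluteGaloisGroup F | σ • a = a} ∈ 𝓝 (1 : absoluteGaloisGroup F) := by
    refine Filter.mem_of_superset (setOf_smul_eq_mem_nhds_one F (a : AlgebraicClosure F)) ?_
    intro σ hσ
    exact Units.ext (by rw [Units.coe_smul]; exact hσ)
  -- an open normal subgroup inside `U₁ ∩ U₂ ∩ Stab(a)`
  obtain ⟨W, hWopen, h1W, hWsub⟩ : ∃ W : Set (absoluteGaloisGroup F), IsOpen W ∧ (1 : absoluteGaloisGroup F) ∈ W ∧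
      W ⊆ U₁ ∩ U₂ ∩ {σ | σ • a = a} := by
    obtain ⟨W, hWsub, hWopen, h1W⟩ := mem_nhds_iff.mp (Filter.inter_mem (Filter.inter_mem hU₁ hU₂) hS)
    exact ⟨W, hWopen, h1W, hWsub⟩
  obtain ⟨N, hN⟩ := ProfiniteGrp.exist_openNormalSubgroup_sub_open_nhds_of_one hWopen h1W
  have hNU : ∀ x ∈ (N : Subgroup (absoluteGaloisGroup F)), ∀ y ∈ (N : Subgroup (absoluteGaloisGroup F)),
      e x y = a := fun x hx y hy =>
    hUU (Set.mk_mem_prod (hWsub (hN hx)).1.1 (hWsub (hN hy)).1.2)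
  have hNa : ∀ x ∈ (N : Subgroup (absoluteGaloisGroup F)), x • a = a := fun x hx => (hWsub (hN hx)).2
  -- `N = Gal(F̄/L)` for a finite Galois `L`
  haveI : (N : Subgroup (absoluteGaloisGroup F)).Normal := N.isNormal'
  obtain ⟨L, hLfin, hLgal, hLN⟩ := exists_isGalois_fixingSubgroup_eq (F := F) (E := AlgebraicClosure F)
    (N : Subgroup (absoluteGaloisGroup F)) N.isOpen'
  refine ⟨L, hLfin, hLgal, fun _ => a, IsLocallyConstant.const a, fun x y => ?_⟩
  have hmem : ∀ z : LocalWeilDatum.galFixing F L, (z : absoluteGaloisGroup F) ∈ (N : Subgroup (absoluteGaloisGroup F)) := by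
    intro z
    rw [← hLN]
    exact z.2
  rw [hNU x (hmem x) y (hmem y), hNa x (hmem x), mul_div_cancel_right]

end FiniteLevel




end Literature.NumberTheory.GaloisRepresentations
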